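import Mathlib
import Literature.MathematicalPhysics.QuantumFieldTheory.Luscher2010.TrivializingMaps
import Literature.MathematicalPhysics.QuantumFieldTheory.Luscher2010.FlowActionSeries
import Summits.Ventures.LatticeQCDFlow.TrivializingMaps.Truncation
import HarnessLib

/-!
# The exact defect identity of the truncated Lüscher series — proof of `TruncationDefectIdentity`

HONEST FRAMING: exact (Metropolis-corrected) sampling algorithms for lattice gauge theory; figures of merit are
autocorrelation/cost numbers at stated couplings and volumes; no continuum-physics claim.

This file PROVES the venture's typed target `TruncationDefectIdentity d L n` (`Truncation.lean` §2): for a smooth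
action `S`, smooth orders `S̃^{(k)}` and constants `Ċ^{(k)}` satisfying Lüscher's recursion (4.12)–(4.13)
(`IsLuscherSeries B S Sk c`), the order-`N` truncation `S̃^{[N]}_t = ∑_{k≤N} t^k S̃^{(k)}` satisfies the
trivializing-flow equation (4.5) EXACTLY up to one explicit term,
`𝓛_t S̃^{[N]}_t = S + ∑_{k≤N} t^k Ċ^{(k)} + t^{N+1} 𝓥 S̃^{(N)}` pointwise on `SU(n)^E`
(`𝓛_t = Δ + t𝓥`, `𝓥 f = ∑ (∂ᵃS)(∂ᵃf)`; Lüscher 2010 §4.5(c): "an additive correction of order `t^{n+1}`").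

The content is the LINK CALCULUS that makes `Δ = linkLap B` and `𝓥 = luscherV B S` linear on smooth field
functionals (§1): along the link curve `s ↦ (e^{sX} W(e), W(e'))` the link derivative of a differentiable `f` is
the Fréchet derivative applied to the tangent vector `δ_e · X W(e)` (`linkDeriv_eq_fderiv`), hence additive, and
`W ↦ ∂_{e,X} f (W)` is again smooth (`contDiff_linkDeriv`), so the second derivatives in `Δ` are additive too.
§2 is then the telescoping induction on `N` (the abstract version is `luscherOp_truncSeries`).

References: M. Lüscher, Trivializing maps, the Wilson flow and the HMC algorithm, CMP 293 (2010) 899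
[Luscher2010Trivializing, arXiv:0907.5491], §4.2 eq. (4.6), §4.3 eqs. (4.11)–(4.13), §4.5(c), App. A eqs. (A.3)–(A.4).
-/

namespace Summit.Ventures.LatticeQCDFlow.TrivializingMaps

open Literature.MathematicalPhysics.QuantumFieldTheory
open Literature.MathematicalPhysics.QuantumFieldTheory.Luscher2010
open scoped Matrix Matrix.Norms.Frobenius ContDiff

variable {d L n : ℕ}

/-! ## §1. Link calculus for differentiable field functionals -/

section LinkCalculus

/-- The link curve `s ↦ (e^{sX} W(e) at e, W elsewhere)` has velocity `δ_e · X W(e)` at `s = 0`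
(Lüscher's definition (2.2)/(A.3) of `∂_{e,X}`). [folklore] -/
theorem hasDerivAt_linkCurve (W : AmbConfig d L n) (e : Edge d L) (X : Matrix (Fin n) (Fin n) ℂ) :
    HasDerivAt (fun s : ℝ => Function.update W e (NormedSpace.exp ((s : ℂ) • X) * W e))
      (Pi.single e (X * W e)) 0 := by
  refine hasDerivAt_pi.2 fun e' => ?_
  rcases eq_or_ne e' e with rfl | hne
  · simp only [Function.update_self, Pi.single_eq_same]
    have h := (hasDerivAt_exp_smul_const' (𝕂 := ℝ) X (0 : ℝ)).mul_const (W e')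
    rw [zero_smul, NormedSpace.exp_zero, mul_one] at h
    have hfun : (fun s : ℝ => NormedSpace.exp ((s : ℂ) • X) * W e') =
        fun s : ℝ => NormedSpace.exp (s • X) * W e' := by
      funext s; rw [Complex.coe_smul]
    rw [hfun]
    exact h
  · simp only [Function.update_of_ne hne, Pi.single_eq_of_ne hne]
    exact hasDerivAt_const _ _

/-- The link curve passes through `W` at `s = 0`. [folklore] -/
theorem linkCurve_zero (W : AmbConfig d L n) (e : Edge d L) (X : Matrix (Fin n) (Fin n) ℂ) :
    Function.update W e (NormedSpace.exp (((0 : ℝ) : ℂ) • X) * W e) = W := by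
  rw [Complex.ofReal_zero, zero_smul, NormedSpace.exp_zero, one_mul, Function.update_eq_self]

/-- `∂_{e,X}` commutes with constant factors (no differentiability needed). [folklore] -/
theorem linkDeriv_const_mul' (e : Edge d L) (X : Matrix (Fin n) (Fin n) ℂ) (a : ℝ)
    (f : AmbConfig d L n → ℝ) (W : AmbConfig d L n) :
    linkDeriv e X (fun W' => a * f W') W = a * linkDeriv e X f W := by
  unfold linkDeriv
  exact deriv_const_mul_field a

variable [NeZero L]
-- From here on the normed structure on `AmbConfig d L n = (Site d L × Fin d → M_n(ℂ))` is used (Fréchet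
-- derivatives, `ContDiff`); it needs `Fintype (Site d L)`, i.e. `[NeZero L]`.

/-- **Chain rule along a link curve**: for `f` differentiable at `W`,
`d/ds f(e^{sX} W(e), …)|₀ = Df(W)[δ_e · X W(e)]`. [folklore] -/
theorem hasDerivAt_comp_linkCurve {f : AmbConfig d L n → ℝ} {W : AmbConfig d L n}
    (hf : DifferentiableAt ℝ f W) (e : Edge d L) (X : Matrix (Fin n) (Fin n) ℂ) :
    HasDerivAt (fun s : ℝ => f (Function.update W e (NormedSpace.exp ((s : ℂ) • X) * W e)))
      (fderiv ℝ f W (Pi.single e (X * W e))) 0 :=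
  hf.hasFDerivAt.comp_hasDerivAt_of_eq (0 : ℝ) (hasDerivAt_linkCurve W e X) (linkCurve_zero W e X).symm

/-- **The link derivative is the Fréchet derivative on the tangent vector `δ_e · X W(e)`** (for `f`
differentiable at `W`; eq. (A.3)). [cite: Luscher2010Trivializing, App. A eq. (A.3)] -/
theorem linkDeriv_eq_fderiv {f : AmbConfig d L n → ℝ} {W : AmbConfig d L n} (hf : DifferentiableAt ℝ f W)
    (e : Edge d L) (X : Matrix (Fin n) (Fin n) ℂ) :
    linkDeriv e X f W = fderiv ℝ f W (Pi.single e (X * W e)) := by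
  unfold linkDeriv
  exact (hasDerivAt_comp_linkCurve hf e X).deriv

/-- Additivity of `∂_{e,X}` on functions differentiable at the point. [cite: Luscher2010Trivializing, App. A eq. (A.3)] -/
theorem linkDeriv_add_of_differentiableAt (e : Edge d L) (X : Matrix (Fin n) (Fin n) ℂ)
    {f g : AmbConfig d L n → ℝ} {W : AmbConfig d L n} (hf : DifferentiableAt ℝ f W)
    (hg : DifferentiableAt ℝ g W) :
    linkDeriv e X (fun W' => f W' + g W') W = linkDeriv e X f W + linkDeriv e X g W := by
  rw [linkDeriv_eq_fderiv (f := fun W' => f W' + g W') (hf.add hg) e X, linkDeriv_eq_fderiv hf,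
    linkDeriv_eq_fderiv hg,
    show fderiv ℝ (fun W' => f W' + g W') W = fderiv ℝ f W + fderiv ℝ g W from fderiv_add hf hg]
  rfl

/-- The tangent field `W ↦ δ_e · X W(e)` is smooth (it is linear). [folklore] -/
theorem contDiff_pi_single_mul_apply (e : Edge d L) (X : Matrix (Fin n) (Fin n) ℂ) :
    ContDiff ℝ ∞ (fun W : AmbConfig d L n => (Pi.single e (X * W e) : AmbConfig d L n)) := by
  refine contDiff_pi.2 fun e' => ?_
  rcases eq_or_ne e' e with rfl | hne
  · simp only [Pi.single_eq_same]
    exact contDiff_const.mul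
      ((ContinuousLinearMap.proj (R := ℝ) (φ := fun _ : Edge d L => Matrix (Fin n) (Fin n) ℂ) e').contDiff)
  · simp only [Pi.single_eq_of_ne hne]
    exact contDiff_const

/-- **`∂_{e,X}` preserves smoothness**: for smooth `f`, `W ↦ ∂_{e,X} f(W) = Df(W)[δ_e · X W(e)]` is smooth.
[cite: Luscher2010Trivializing, App. A eq. (A.3)] -/
theorem contDiff_linkDeriv {f : AmbConfig d L n → ℝ} (hf : ContDiff ℝ ∞ f) (e : Edge d L)
    (X : Matrix (Fin n) (Fin n) ℂ) : ContDiff ℝ ∞ (linkDeriv e X f) := by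
  have hfun : linkDeriv e X f = fun W => fderiv ℝ f W (Pi.single e (X * W e)) :=
    funext fun W => linkDeriv_eq_fderiv (hf.differentiable (by simp) W) e X
  rw [hfun]
  exact (hf.fderiv_right (m := ∞) le_rfl).clm_apply (contDiff_pi_single_mul_apply e X)

/-- **Additivity of Lüscher's Laplacian `Δ = -∑ ∂ᵃ∂ᵃ` on smooth functions.** [cite: Luscher2010Trivializing, §4.2 eq. (4.6)] -/
theorem linkLap_add_of_contDiff (B : SuBasis n) {f g : AmbConfig d L n → ℝ}
    (hf : ContDiff ℝ ∞ f) (hg : ContDiff ℝ ∞ g) (W : AmbConfig d L n) :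
    linkLap B (fun W' => f W' + g W') W = linkLap B f W + linkLap B g W := by
  unfold linkLap
  have inner : ∀ (e : Edge d L) (a : B.ι), linkDeriv e (B.T a) (fun W' => f W' + g W') =
      fun W' => linkDeriv e (B.T a) f W' + linkDeriv e (B.T a) g W' := fun e a =>
    funext fun W' => linkDeriv_add_of_differentiableAt e (B.T a)
      (hf.differentiable (by simp) W') (hg.differentiable (by simp) W')
  have outer : ∀ (e : Edge d L) (a : B.ι),
      linkDeriv e (B.T a) (linkDeriv e (B.T a) (fun W' => f W' + g W')) W =
        linkDeriv e (B.T a) (linkDeriv e (B.T a) f) W + linkDeriv e (B.T a) (linkDeriv e (B.T a) g) W := by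
    intro e a
    rw [inner e a]
    exact linkDeriv_add_of_differentiableAt e (B.T a)
      ((contDiff_linkDeriv hf e (B.T a)).differentiable (by simp) W)
      ((contDiff_linkDeriv hg e (B.T a)).differentiable (by simp) W)
  simp only [outer, Finset.sum_add_distrib, neg_add]

/-- `Δ` commutes with constant factors. [folklore] -/
theorem linkLap_const_mul' (B : SuBasis n) (a : ℝ) (f : AmbConfig d L n → ℝ)
    (W : AmbConfig d L n) : linkLap B (fun W' => a * f W') W = a * linkLap B f W := by
  unfold linkLap
  have h : ∀ (e : Edge d L) (b : B.ι),
      linkDeriv e (B.T b) (linkDeriv e (B.T b) fun W' => a * f W') W =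
        a * linkDeriv e (B.T b) (linkDeriv e (B.T b) f) W := by
    intro e b
    have hfun : (linkDeriv e (B.T b) fun W' => a * f W') = fun W' => a * linkDeriv e (B.T b) f W' :=
      funext fun W' => linkDeriv_const_mul' e (B.T b) a f W'
    rw [hfun, linkDeriv_const_mul']
  simp_rw [h, ← Finset.mul_sum]
  ring

/-- **Additivity of `𝓥 f = ∑ (∂ᵃS)(∂ᵃf)` in `f`** (functions differentiable at the point).
[cite: Luscher2010Trivializing, §4.2 eq. (4.6)] -/
theorem luscherV_add_of_differentiableAt (B : SuBasis n) (S : AmbConfig d L n → ℝ)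
    {f g : AmbConfig d L n → ℝ} {W : AmbConfig d L n} (hf : DifferentiableAt ℝ f W)
    (hg : DifferentiableAt ℝ g W) :
    luscherV B S (fun W' => f W' + g W') W = luscherV B S f W + luscherV B S g W := by
  unfold luscherV
  simp only [linkDeriv_add_of_differentiableAt _ _ hf hg, mul_add, Finset.sum_add_distrib]

/-- `𝓥` commutes with constant factors in `f`. [folklore] -/
theorem luscherV_const_mul' (B : SuBasis n) (S : AmbConfig d L n → ℝ) (a : ℝ)
    (f : AmbConfig d L n → ℝ) (W : AmbConfig d L n) :
    luscherV B S (fun W' => a * f W') W = a * luscherV B S f W := by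
  unfold luscherV
  simp only [linkDeriv_const_mul', Finset.mul_sum]
  exact Finset.sum_congr rfl fun e _ => Finset.sum_congr rfl fun b _ => by ring

end LinkCalculus

/-! ## §2. The truncated flow action and the defect identity -/

section Defect

/-- The truncated flow action is smooth when its orders are. [folklore] -/
theorem contDiff_truncFlowAction [NeZero L] {Sk : ℕ → AmbConfig d L n → ℝ} (hSk : ∀ k, ContDiff ℝ ∞ (Sk k))
    (t : ℝ) (N : ℕ) : ContDiff ℝ ∞ (truncFlowAction Sk t N) := by
  unfold truncFlowAction
  exact ContDiff.sum fun k _ => contDiff_const.mul (hSk k)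

/-- Order `0`: `S̃^{[0]}_t = S̃^{(0)}`. [folklore] -/
theorem truncFlowAction_zero (Sk : ℕ → AmbConfig d L n → ℝ) (t : ℝ) : truncFlowAction Sk t 0 = Sk 0 := by
  funext W
  simp [truncFlowAction]

/-- Order `N+1`: `S̃^{[N+1]}_t = S̃^{[N]}_t + t^{N+1} S̃^{(N+1)}`. [folklore] -/
theorem truncFlowAction_succ (Sk : ℕ → AmbConfig d L n → ℝ) (t : ℝ) (N : ℕ) :
    truncFlowAction Sk t (N + 1) = fun W => truncFlowAction Sk t N W + t ^ (N + 1) * Sk (N + 1) W := by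
  funext W
  simp [truncFlowAction, Finset.sum_range_succ]

/-- **The exact defect identity** (`TruncationDefectIdentity`, PROVED): for smooth `S̃^{(k)}` satisfying
Lüscher's recursion, `𝓛_t S̃^{[N]}_t = S + ∑_{k≤N} t^k Ċ^{(k)} + t^{N+1} 𝓥 S̃^{(N)}` on `SU(n)^E` — the
truncation solves (4.5) up to the single explicit term `t^{N+1} 𝓥 S̃^{(N)}` (§4.5(c) in closed form). The
smoothness of `S` in the hypothesis is not used. [cite: Luscher2010Trivializing, §4.3 eqs. (4.11)–(4.13), §4.5(c)] -/
theorem truncationDefectIdentity_holds : TruncationDefectIdentity d L n := by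
  intro _ B S Sk c _ hSk hser t N U
  induction N with
  | zero =>
    rw [truncFlowAction_zero, luscherL_eq, hser.1 U, Finset.sum_range_one, pow_zero, one_mul, zero_add,
      pow_one]
  | succ N ih =>
    have hk : linkLap B (Sk (N + 1)) (WilsonFlow.coeConfig U) =
        -luscherV B S (Sk N) (WilsonFlow.coeConfig U) + c (N + 1) := hser.2 N U
    have hg : ContDiff ℝ ∞ (fun W => t ^ (N + 1) * Sk (N + 1) W) := contDiff_const.mul (hSk (N + 1))
    rw [luscherL_eq] at ih ⊢
    rw [truncFlowAction_succ, linkLap_add_of_contDiff B (contDiff_truncFlowAction hSk t N) hg,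
      linkLap_const_mul', luscherV_add_of_differentiableAt B S
        ((contDiff_truncFlowAction hSk t N).differentiable (by simp) _) (hg.differentiable (by simp) _),
      luscherV_const_mul', hk, Finset.sum_range_succ (fun k => t ^ k * c k) (N + 1)]
    linear_combination ih

end Defect

end Summit.Ventures.LatticeQCDFlow.TrivializingMaps
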